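import Summits.CriticalPhenomena.CardyFormulaZ2.Theorems.CardyIKTransportIKLinearTransportSDECore6

/-!
# Stub `stub_StripDiagramExchange` — core part 7: the blocking estimate, upper slots

Continues `…SDECore6`. An abstract renewal bound on the core space (`SDE.blocking_abstract`: if each of `k` steps
contains a fresh box of probability `≥ δ` adjusted to past statistics, none of the `k` events happens with probability
`≤ (1-δ)^k`), and its instance for the UPPER SLOTS: rows `y_j, y_j + 1`, `y_j = n + 2 + 2j`, of the strip are
monochromatic of opposite colours with probability `≥ q^6` given the past, so `P(no blocking pair among k slots)
≤ (1 - q^6)^k` (`SDE.P_noBlockU`).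
-/

set_option autoImplicit false

noncomputable section

namespace Summit.CriticalPhenomena.CardyFormulaZ2.Theorems.IKLinearTransport.PinnedDiagramExchange

open scoped Classical MeasureTheory ENNReal ProbabilityTheory BigOperators
open MeasureTheory Literature.Probability.Percolation Literature.Probability.LatticeModels

namespace SDE

/-! ## §17 The blocking estimate: an abstract renewal bound on the core space -/

/-- Chains of coordinate sets. [folklore] -/
theorem chain_mono (S : ℕ → Finset Idx) (hS : ∀ j, S j ⊆ S (j + 1)) {i j : ℕ} (hij : i ≤ j) : S i ⊆ S j := by
  induction hij with
  | refl => exact le_rfl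
  | step _ ih => exact ih.trans (hS _)

/-- ABSTRACT BLOCKING BOUND: if at each step `j` an event `A j` contains a "fresh box" `Bx j t₁ t₂` of probability `≥ δ`
(on fresh bits `Φ j`, disjoint from the past `S j`) adjusted to past statistics `T₁ j, T₂ j`, then the probability that
none of `A 0, …, A (k-1)` happens is at most `(1 - δ)^k`. [folklore] -/
theorem blocking_abstract (A : ℕ → Set K) (S Φ : ℕ → Finset Idx) (T₁ T₂ : ℕ → K → Bool)
    (Bx : ℕ → Bool → Bool → Set K) (δ : ℝ)
    (hSmono : ∀ j, S j ⊆ S (j + 1)) (hdisj : ∀ j, Disjoint (S j) (Φ j))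
    (hA : ∀ j, A j ∈ DetSets (S (j + 1)))
    (hT : ∀ j t, {b | T₁ j b = t} ∈ DetSets (S j) ∧ {b | T₂ j b = t} ∈ DetSets (S j))
    (hBx : ∀ j t₁ t₂, Bx j t₁ t₂ ∈ DetSets (Φ j)) (hBxP : ∀ j t₁ t₂, δ ≤ P.real (Bx j t₁ t₂))
    (hsub : ∀ j t₁ t₂, Bx j t₁ t₂ ∩ {b | T₁ j b = t₁} ∩ {b | T₂ j b = t₂} ⊆ A j) :
    ∀ k, P.real (⋂ j ∈ Finset.range k, (A j)ᶜ) ≤ (1 - δ) ^ k := by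
  have hNBdet : ∀ k, (⋂ j ∈ Finset.range k, (A j)ᶜ) ∈ DetSets (S k) := by
    intro k
    induction k with
    | zero => intro b b' _; simp
    | succ k ih =>
      have e : (⋂ j ∈ Finset.range (k + 1), (A j)ᶜ) = (⋂ j ∈ Finset.range k, (A j)ᶜ) ∩ (A k)ᶜ := by
        ext b; simp only [Set.mem_iInter, Set.mem_inter_iff, Finset.mem_range]
        exact ⟨fun h => ⟨fun j hj => h j (by omega), h k (by omega)⟩, fun ⟨h1, h2⟩ j hj => by
          rcases Nat.lt_succ_iff_lt_or_eq.1 hj with hj | rfl; exacts [h1 j hj, h2]⟩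
      rw [e]
      exact det_inter (det_mono (hSmono k) ih) (det_compl (hA k))
  have hδ1 : ∀ j t₁ t₂, P.real (Bx j t₁ t₂)ᶜ ≤ 1 - δ := fun j t₁ t₂ => by
    rw [measureReal_compl (measurableSet_of_det _ (hBx j t₁ t₂)), probReal_univ]; linarith [hBxP j t₁ t₂]
  intro k
  induction k with
  | zero => simp
  | succ k ih =>
    have e : (⋂ j ∈ Finset.range (k + 1), (A j)ᶜ) = (⋂ j ∈ Finset.range k, (A j)ᶜ) ∩ (A k)ᶜ := by
      ext b; simp only [Set.mem_iInter, Set.mem_inter_iff, Finset.mem_range]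
      exact ⟨fun h => ⟨fun j hj => h j (by omega), h k (by omega)⟩, fun ⟨h1, h2⟩ j hj => by
        rcases Nat.lt_succ_iff_lt_or_eq.1 hj with hj | rfl; exacts [h1 j hj, h2]⟩
    rw [e]
    set C := ⋂ j ∈ Finset.range k, (A j)ᶜ with hC
    have hCdet : C ∈ DetSets (S k) := hNBdet k
    have hCm : MeasurableSet C := measurableSet_of_det _ hCdet
    have hAm : MeasurableSet (A k) := measurableSet_of_det _ (hA k)
    have hTm : ∀ t, MeasurableSet {b | T₁ k b = t} ∧ MeasurableSet {b | T₂ k b = t} := fun t =>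
      ⟨measurableSet_of_det _ (hT k t).1, measurableSet_of_det _ (hT k t).2⟩
    -- split along the past statistics
    have hstep : ∀ t₁ t₂, P.real (C ∩ (A k)ᶜ ∩ {b | T₁ k b = t₁} ∩ {b | T₂ k b = t₂}) ≤
        P.real (C ∩ {b | T₁ k b = t₁} ∩ {b | T₂ k b = t₂}) * (1 - δ) := fun t₁ t₂ => by
      calc P.real (C ∩ (A k)ᶜ ∩ {b | T₁ k b = t₁} ∩ {b | T₂ k b = t₂})
          ≤ P.real ((C ∩ {b | T₁ k b = t₁} ∩ {b | T₂ k b = t₂}) ∩ (Bx k t₁ t₂)ᶜ) := by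
            refine measureReal_mono ?_
            rintro b ⟨⟨⟨hc, ha⟩, h1⟩, h2⟩
            exact ⟨⟨⟨hc, h1⟩, h2⟩, fun hbx => ha (hsub k t₁ t₂ ⟨⟨hbx, h1⟩, h2⟩)⟩
        _ = P.real (C ∩ {b | T₁ k b = t₁} ∩ {b | T₂ k b = t₂}) * P.real (Bx k t₁ t₂)ᶜ :=
            Preal_inter_det (hdisj k) (det_inter (det_inter hCdet (hT k t₁).1) (hT k t₂).2) (det_compl (hBx k t₁ t₂))
        _ ≤ P.real (C ∩ {b | T₁ k b = t₁} ∩ {b | T₂ k b = t₂}) * (1 - δ) :=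
            mul_le_mul_of_nonneg_left (hδ1 k t₁ t₂) measureReal_nonneg
    have hsplitL : P.real (C ∩ (A k)ᶜ) = ∑ t₁ : Bool, ∑ t₂ : Bool, P.real (C ∩ (A k)ᶜ ∩ {b | T₁ k b = t₁} ∩ {b | T₂ k b = t₂}) := by
      rw [Preal_split _ (hCm.inter hAm.compl) (T₁ k) (fun t => (hTm t).1),
        Preal_split _ ((hCm.inter hAm.compl).inter (hTm _).1) (T₂ k) (fun t => (hTm t).2),
        Preal_split _ ((hCm.inter hAm.compl).inter (hTm _).1) (T₂ k) (fun t => (hTm t).2)]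
      simp only [Fintype.sum_bool]; ring
    have hsplitR : P.real C = ∑ t₁ : Bool, ∑ t₂ : Bool, P.real (C ∩ {b | T₁ k b = t₁} ∩ {b | T₂ k b = t₂}) := by
      rw [Preal_split _ hCm (T₁ k) (fun t => (hTm t).1), Preal_split _ (hCm.inter (hTm _).1) (T₂ k) (fun t => (hTm t).2),
        Preal_split _ (hCm.inter (hTm _).1) (T₂ k) (fun t => (hTm t).2)]
      simp only [Fintype.sum_bool]; ring
    calc P.real (C ∩ (A k)ᶜ) = _ := hsplitL
      _ ≤ ∑ t₁ : Bool, ∑ t₂ : Bool, P.real (C ∩ {b | T₁ k b = t₁} ∩ {b | T₂ k b = t₂}) * (1 - δ) :=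
          Finset.sum_le_sum fun t₁ _ => Finset.sum_le_sum fun t₂ _ => hstep t₁ t₂
      _ = P.real C * (1 - δ) := by rw [hsplitR]; simp only [Fintype.sum_bool]; ring
      _ ≤ (1 - δ) ^ k * (1 - δ) := mul_le_mul_of_nonneg_right ih (by linarith [hδ1 0 false false, (measureReal_nonneg : 0 ≤ P.real (Bx 0 false false)ᶜ)])
      _ = (1 - δ) ^ (k + 1) := by ring

/-! ## §18 Blocking pairs of rows above the starts -/

/-- Target constants of the plaquette parities on a monochromatic row. [folklore] -/
def κk (τ κ₀ κ₂ : Bool) (k : Fin 5) : Bool := if k = kL τ then κ₀ else κ₂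

/-- Rows of the `j`-th upper slot: `y_j, y_j + 1` with `y_j = n + 2 + 2j`. [folklore] -/
def yU (n j : ℕ) : ℤ := n + 2 + 2 * j

/-- BLOCKING EVENT of the upper slot `j`: rows `y_j` and `y_j + 1` of the strip are monochromatic of opposite colours. [folklore] -/
def AU (τ κ₀ κ₂ : Bool) (n j : ℕ) : Set K :=
  {b | ∃ β : Bool, (∀ c : Fin 3, col τ κ₀ κ₂ b c (yU n j) = β) ∧ ∀ c : Fin 3, col τ κ₀ κ₂ b c (yU n j + 1) = !β}

/-- Past bits of the upper slot `j`. [folklore] -/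
def SU (n j : ℕ) : Finset Idx :=
  {((4 : Fin 5), (1 : ℤ))} ∪ ((({1, 3} : Finset (Fin 5)) ×ˢ Finset.Ico 0 (yU n j - 1)) ∪ (({0} : Finset (Fin 5)) ×ˢ Finset.Icc 0 (yU n j - 1)))

/-- Fresh bits of the upper slot `j`. [folklore] -/
def ΦU (n j : ℕ) : Finset Idx :=
  {((1 : Fin 5), yU n j - 1), ((3 : Fin 5), yU n j - 1), ((1 : Fin 5), yU n j), ((3 : Fin 5), yU n j),
    ((0 : Fin 5), yU n j), ((0 : Fin 5), yU n j + 1)}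

/-- The fresh box of the upper slot `j`. [folklore] -/
def βU (n j : ℕ) (t₁ t₂ : Bool) (idx : Idx) : Bool :=
  if idx = ((1 : Fin 5), yU n j - 1) then t₁ else if idx = ((3 : Fin 5), yU n j - 1) then t₂
  else if idx = ((0 : Fin 5), yU n j + 1) then true else false

/-- Past statistics of the upper slot `j`: the parities below the slot, re-centred at their targets. [folklore] -/
def TU (τ κ₀ κ₂ : Bool) (k : Fin 5) (n j : ℕ) (b : K) : Bool :=
  bp (fun s => b (k, s)) 0 (yU n j - 1) ^^ b (4, 1) ^^ κk τ κ₀ κ₂ k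

/-- Membership in the past of an upper slot. [folklore] -/
theorem mem_SU (n j : ℕ) (k : Fin 5) (y : ℤ) : (k, y) ∈ SU n j ↔
    (k = 4 ∧ y = 1) ∨ ((k = 1 ∨ k = 3) ∧ 0 ≤ y ∧ y < yU n j - 1) ∨ (k = 0 ∧ 0 ≤ y ∧ y ≤ yU n j - 1) := by
  simp only [SU, Finset.mem_union, Finset.mem_singleton, Prod.mk.injEq, Finset.mem_product, Finset.mem_insert,
    Finset.mem_Ico, Finset.mem_Icc]

/-- Membership in the fresh bits of an upper slot. [folklore] -/
theorem mem_ΦU (n j : ℕ) (k : Fin 5) (y : ℤ) : (k, y) ∈ ΦU n j ↔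
    ((k = 1 ∨ k = 3) ∧ (y = yU n j - 1 ∨ y = yU n j)) ∨ (k = 0 ∧ (y = yU n j ∨ y = yU n j + 1)) := by
  simp only [ΦU, Finset.mem_insert, Finset.mem_singleton, Prod.mk.injEq]
  constructor
  · rintro (⟨rfl, rfl⟩ | ⟨rfl, rfl⟩ | ⟨rfl, rfl⟩ | ⟨rfl, rfl⟩ | ⟨rfl, rfl⟩ | ⟨rfl, rfl⟩) <;> simp
  · rintro (⟨rfl | rfl, rfl | rfl⟩ | ⟨rfl, rfl | rfl⟩) <;> simp

/-- The hypotheses of the abstract bound for the upper slots. [folklore] -/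
theorem slotsU_ok (τ κ₀ κ₂ : Bool) (n : ℕ) :
    (∀ j, SU n j ⊆ SU n (j + 1)) ∧ (∀ j, Disjoint (SU n j) (ΦU n j)) ∧
    (∀ j, AU τ κ₀ κ₂ n j ∈ DetSets (SU n (j + 1))) ∧
    (∀ j t, {b | TU τ κ₀ κ₂ 1 n j b = t} ∈ DetSets (SU n j) ∧ {b | TU τ κ₀ κ₂ 3 n j b = t} ∈ DetSets (SU n j)) ∧
    (∀ j t₁ t₂, Set.pi ↑(ΦU n j) (fun idx => {βU n j t₁ t₂ idx}) ∈ DetSets (ΦU n j)) ∧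
    (∀ j t₁ t₂, (qI : ℝ) ^ 6 ≤ P.real (Set.pi ↑(ΦU n j) (fun idx => {βU n j t₁ t₂ idx}))) ∧
    (∀ j t₁ t₂, Set.pi ↑(ΦU n j) (fun idx => {βU n j t₁ t₂ idx}) ∩ {b | TU τ κ₀ κ₂ 1 n j b = t₁} ∩
      {b | TU τ κ₀ κ₂ 3 n j b = t₂} ⊆ AU τ κ₀ κ₂ n j) := by
  have hy : ∀ j, yU n (j + 1) = yU n j + 2 := fun j => by simp only [yU]; push_cast; ring
  have hy0 : ∀ j, (2 : ℤ) ≤ yU n j := fun j => by simp only [yU]; omega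
  refine ⟨fun j => ?_, fun j => ?_, fun j => ?_, fun j t => ?_, fun j t₁ t₂ => ?_, fun j t₁ t₂ => ?_, fun j t₁ t₂ => ?_⟩
  · rintro ⟨k, y⟩ h; rw [mem_SU] at h ⊢; rw [hy]; have := hy0 j; omega
  · rw [Finset.disjoint_left]; rintro ⟨k, y⟩ h1 h2; rw [mem_SU] at h1; rw [mem_ΦU] at h2; have := hy0 j; omega
  · -- the blocking event reads the past of the next slot
    intro b b' hb
    have e : ∀ (c : Fin 3) (y : ℤ), (y = yU n j ∨ y = yU n j + 1) → col τ κ₀ κ₂ b c y = col τ κ₀ κ₂ b' c y := by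
      intro c y hyy
      have h0 : b (0, y) = b' (0, y) := hb _ ((mem_SU n (j + 1) 0 y).2 (by rw [hy]; have := hy0 j; omega))
      have h4 : b (4, 1) = b' (4, 1) := hb _ ((mem_SU n (j + 1) 4 1).2 (Or.inl ⟨rfl, rfl⟩))
      have hk : ∀ k : Fin 5, (k = 1 ∨ k = 3) → bp (fun s => b (k, s)) 0 y = bp (fun s => b' (k, s)) 0 y :=
        fun k hk => bp_congr fun s hs1 hs2 => hb _ ((mem_SU n (j + 1) k s).2 (Or.inr (Or.inl ⟨hk, by
          rw [hy]; have := hy0 j; omega⟩)))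
      have h13 : ∀ τ' : Bool, (kL τ' = 1 ∨ kL τ' = 3) := by decide
      fin_cases c
      · simp only [Fin.zero_eta, col_zero, h0]
      · simp only [Fin.mk_one, col_one, h0, h4, hk (kL τ) (h13 τ)]
      · simp only [Fin.reduceFinMk, col_two, h0, hk 1 (Or.inl rfl), hk 3 (Or.inr rfl)]
    simp only [AU, Set.mem_setOf_eq]
    constructor
    · rintro ⟨β, h1, h2⟩; exact ⟨β, fun c => by rw [← e c _ (Or.inl rfl)]; exact h1 c, fun c => by rw [← e c _ (Or.inr rfl)]; exact h2 c⟩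
    · rintro ⟨β, h1, h2⟩; exact ⟨β, fun c => by rw [e c _ (Or.inl rfl)]; exact h1 c, fun c => by rw [e c _ (Or.inr rfl)]; exact h2 c⟩
  · -- the statistics read the past
    have key : ∀ k : Fin 5, (k = 1 ∨ k = 3) → {b | TU τ κ₀ κ₂ k n j b = t} ∈ DetSets (SU n j) := fun k hk b b' hb => by
      have h4 : b (4, 1) = b' (4, 1) := hb _ ((mem_SU n j 4 1).2 (Or.inl ⟨rfl, rfl⟩))
      have hk' : bp (fun s => b (k, s)) 0 (yU n j - 1) = bp (fun s => b' (k, s)) 0 (yU n j - 1) :=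
        bp_congr fun s hs1 hs2 => hb _ ((mem_SU n j k s).2 (Or.inr (Or.inl ⟨hk, by have := hy0 j; omega⟩)))
      simp only [Set.mem_setOf_eq, TU, h4, hk']
    exact ⟨key 1 (Or.inl rfl), key 3 (Or.inr rfl)⟩
  · -- boxes read their bits
    intro b b' hb
    simp only [Set.mem_pi, Finset.mem_coe, Set.mem_singleton_iff]
    exact ⟨fun h idx hidx => by rw [← hb idx hidx]; exact h idx hidx, fun h idx hidx => by rw [hb idx hidx]; exact h idx hidx⟩
  · -- boxes are likely
    have hq := qI_val
    rw [measureReal_def, P_pi, ENNReal.toReal_prod]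
    have hfac : ∀ idx ∈ ΦU n j, (qI : ℝ) ≤ (ENNReal.ofReal (if βU n j t₁ t₂ idx then (wt idx.1 : ℝ) else 1 - wt idx.1)).toReal := by
      intro idx _
      rw [ENNReal.toReal_ofReal (by split_ifs; exacts [(wt idx.1).2.1, sub_nonneg.2 (wt idx.1).2.2])]
      unfold wt; split_ifs <;> (try simp only [coe_half]) <;> linarith
    have hcard : (ΦU n j).card ≤ 6 := by
      unfold ΦU
      refine (Finset.card_insert_le _ _).trans (Nat.succ_le_succ ((Finset.card_insert_le _ _).trans (Nat.succ_le_succ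
        ((Finset.card_insert_le _ _).trans (Nat.succ_le_succ ((Finset.card_insert_le _ _).trans (Nat.succ_le_succ
        ((Finset.card_insert_le _ _).trans (Nat.succ_le_succ (Finset.card_singleton _).le)))))))))
    calc (qI : ℝ) ^ 6 ≤ (qI : ℝ) ^ (ΦU n j).card := pow_le_pow_of_le_one (by linarith [hq.2.1]) (by linarith [hq.2.2]) hcard
      _ = ∏ idx ∈ ΦU n j, (qI : ℝ) := by rw [Finset.prod_const]
      _ ≤ _ := Finset.prod_le_prod (fun _ _ => hq.2.1.le.trans' (by norm_num)) hfac
  · -- on the box, the rows are monochromatic of opposite colours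
    rintro b ⟨⟨hbox, h1⟩, h3⟩
    rw [Set.mem_pi] at hbox
    have hb : ∀ idx ∈ ΦU n j, b idx = βU n j t₁ t₂ idx := fun idx hidx => Set.mem_singleton_iff.1 (hbox idx (Finset.mem_coe.2 hidx))
    have hβ : ∀ (k : Fin 5) (y : ℤ), βU n j t₁ t₂ (k, y) =
        (if k = 1 ∧ y = yU n j - 1 then t₁ else if k = 3 ∧ y = yU n j - 1 then t₂ else
          if k = 0 ∧ y = yU n j + 1 then true else false) := fun k y => by simp only [βU, Prod.mk.injEq]
    have e1 : b (1, yU n j - 1) = t₁ := by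
      rw [hb _ ((mem_ΦU n j 1 _).2 (Or.inl ⟨Or.inl rfl, Or.inl rfl⟩)), hβ]; simp
    have e3 : b (3, yU n j - 1) = t₂ := by
      rw [hb _ ((mem_ΦU n j 3 _).2 (Or.inl ⟨Or.inr rfl, Or.inl rfl⟩)), hβ]; simp
    have e1' : b (1, yU n j) = false := by
      rw [hb _ ((mem_ΦU n j 1 _).2 (Or.inl ⟨Or.inl rfl, Or.inr rfl⟩)), hβ]
      rw [if_neg (by omega), if_neg (by omega), if_neg (by omega)]
    have e3' : b (3, yU n j) = false := by
      rw [hb _ ((mem_ΦU n j 3 _).2 (Or.inl ⟨Or.inr rfl, Or.inr rfl⟩)), hβ]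
      rw [if_neg (by omega), if_neg (by omega), if_neg (by omega)]
    have e0 : b (0, yU n j) = false := by
      rw [hb _ ((mem_ΦU n j 0 _).2 (Or.inr ⟨rfl, Or.inl rfl⟩)), hβ]
      rw [if_neg (by omega), if_neg (by omega), if_neg (by omega)]
    have e0' : b (0, yU n j + 1) = true := by
      rw [hb _ ((mem_ΦU n j 0 _).2 (Or.inr ⟨rfl, Or.inr rfl⟩)), hβ]
      rw [if_neg (by omega), if_neg (by omega), if_pos ⟨rfl, rfl⟩]
    rw [Set.mem_setOf_eq, TU] at h1 h3
    -- parities at the two rows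
    have hp1 : bp (fun s => b (1, s)) 0 (yU n j) = (b (4, 1) ^^ κk τ κ₀ κ₂ 1) := by
      have := bp_succ (fun s => b (1, s)) (yU n j - 1)
      rw [sub_add_cancel] at this; rw [this, e1]
      revert h1; cases bp (fun s => b (1, s)) 0 (yU n j - 1) <;> cases b (4, 1) <;> cases κk τ κ₀ κ₂ 1 <;> cases t₁ <;> decide
    have hp3 : bp (fun s => b (3, s)) 0 (yU n j) = (b (4, 1) ^^ κk τ κ₀ κ₂ 3) := by
      have := bp_succ (fun s => b (3, s)) (yU n j - 1)
      rw [sub_add_cancel] at this; rw [this, e3]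
      revert h3; cases bp (fun s => b (3, s)) 0 (yU n j - 1) <;> cases b (4, 1) <;> cases κk τ κ₀ κ₂ 3 <;> cases t₂ <;> decide
    have hp1' : bp (fun s => b (1, s)) 0 (yU n j + 1) = (b (4, 1) ^^ κk τ κ₀ κ₂ 1) := by rw [bp_succ, hp1, e1', Bool.xor_false]
    have hp3' : bp (fun s => b (3, s)) 0 (yU n j + 1) = (b (4, 1) ^^ κk τ κ₀ κ₂ 3) := by rw [bp_succ, hp3, e3', Bool.xor_false]
    have hrow : ∀ (y : ℤ) (r : Bool), b (0, y) = r → bp (fun s => b (1, s)) 0 y = (b (4, 1) ^^ κk τ κ₀ κ₂ 1) →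
        bp (fun s => b (3, s)) 0 y = (b (4, 1) ^^ κk τ κ₀ κ₂ 3) → ∀ c : Fin 3, col τ κ₀ κ₂ b c y = (κ₀ ^^ r) := by
      intro y r hr h1 h3 c
      have hL : bp (fun s => b (kL τ, s)) 0 y = (b (4, 1) ^^ κ₀) := by
        cases τ
        · simp only [kL, Bool.false_eq_true, if_false] at h3 ⊢; rw [h3]; simp [κk, kL]
        · simp only [kL, if_true] at h1 ⊢; rw [h1]; simp [κk, kL]
      fin_cases c
      · simp only [Fin.zero_eta, col_zero, hr]
      · simp only [Fin.mk_one, col_one, hr, hL]; cases b (4, 1) <;> cases κ₀ <;> cases r <;> rfl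
      · simp only [Fin.reduceFinMk, col_two, hr, h1, h3]
        cases τ <;> simp [κk, kL] <;> cases b (4, 1) <;> cases κ₀ <;> cases κ₂ <;> cases r <;> rfl
    exact ⟨κ₀ ^^ false, hrow _ _ e0 hp1 hp3, fun c => by rw [hrow _ _ e0' hp1' hp3']; cases κ₀ <;> rfl⟩

/-- THE UPPER BLOCKING BOUND: with probability `≥ 1 - (1 - q^6)^k` one of the first `k` upper slots blocks. [folklore] -/
theorem P_noBlockU (τ κ₀ κ₂ : Bool) (n k : ℕ) :
    P.real (⋂ j ∈ Finset.range k, (AU τ κ₀ κ₂ n j)ᶜ) ≤ (1 - (qI : ℝ) ^ 6) ^ k := by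
  obtain ⟨h1, h3, h4, h5, h6, h7, h8⟩ := slotsU_ok τ κ₀ κ₂ n
  exact blocking_abstract (AU τ κ₀ κ₂ n) (SU n) (ΦU n) (TU τ κ₀ κ₂ 1 n) (TU τ κ₀ κ₂ 3 n)
    (fun j t₁ t₂ => Set.pi ↑(ΦU n j) (fun idx => {βU n j t₁ t₂ idx})) _ h1 h3 h4 h5 h6 h7 h8 k


end SDE

/-- THE UPPER BLOCKING BOUND (part 7 of `stub_StripDiagramExchange`). [folklore] -/
theorem stripDX_noBlockU : ∀ (τ κ₀ κ₂ : Bool) (n k : ℕ), SDE.P.real (⋂ j ∈ Finset.range k, (SDE.AU τ κ₀ κ₂ n j)ᶜ) ≤ (1 - (SDE.qI : ℝ) ^ 6) ^ k :=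
  fun τ κ₀ κ₂ n k => SDE.P_noBlockU τ κ₀ κ₂ n k

end Summit.CriticalPhenomena.CardyFormulaZ2.Theorems.IKLinearTransport.PinnedDiagramExchange
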